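import Summits.CriticalPhenomena.PercolationContinuityZ3.Theorems.PercNearOneGluingNoHeavyLowerTailFourPointRowsLeFive
import Literature.Probability.LatticeModels.SahiThirdOrderCorrelation

/-!
# `NoHeavyLowerTail` (crux stmt-CriticalPhenomena-4575): two further Richards–Sahi `E₃` rows — the INCREASING dual of 3PT-LB and the increasing
# perfect-matching triple — hold on every weighted graph with at most five vertices, for ALL edge weights (kernel-checked, three-copy comb positive)

Support file (prover seat `prim-bnk-1`, bounded-n kernel theorems; `--supports stmt-CriticalPhenomena-4575`; COMPUTATIONAL: the five `checkC` evaluations use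
`native_decide`).  Companion of `…ThreePointRowsLeFive` (rows `H_{q+t} ⟹ AG⁺ ⟹ SHK3⁺ = T_dec`) and `…FourPointRowsLeFive` (`H₄ ⟹ G₄ ⟹ F₄ = E₃` of the decreasing
perfect-matching triple).

* `T_inc` (prim-ineq-prove-2 MEMO-6: with `T_dec` = 3PT-LB the only two 3-point Sahi triples not implied by Harris + AG; exact pseudo-law over that cone,
  `E₃ = −3.60e-3`): for three terminals `a,b,c` and the INCREASING events `U_a = {a↔b} ∪ {a↔c}`, `U_b = {a↔b} ∪ {b↔c}`, `U_c = {a↔c} ∪ {b↔c}`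
  ("the terminal is joined to at least one other terminal"), `E₃(U_a,U_b,U_c) = 2μ(U_aU_bU_c) + μU_aμU_bμU_c − Σ μU_aμ(U_bU_c) ≥ 0`; closed form
  `P(a|b|c)(1 + e₁(ι)) − e₂(ι) − e₃(ι) ≥ 0`, `ι_v = μ(v cut from both other terminals)`.  `T_dec` is prim-lit-2's theorem (2026-08-19, all graphs); `T_inc` is OPEN.
* `K4M_inc`: for four terminals `a,b,c,d` and `U₁ = {a↔b} ∪ {c↔d}`, `U₂ = {a↔c} ∪ {b↔d}`, `U₃ = {a↔d} ∪ {b↔c}` (some pair of the `k`-th perfect matching joined),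
  `E₃(U₁,U₂,U₃) ≥ 0`.  (The decreasing triple `D_k = U_kᶜ` is `F₄`, tree `f4_le_five` / `prodBernoulli_sahiE3_fourPointMatching_eq`.)
Both are instances of Kahn's Conjecture 5 / Sahi's `C₃` for increasing events [Kahn 2022; Sahi 2008], open in general.

**Theorems `tInc_le_five`, `k4mInc_le_five`** (`sahiE3 (prodBernoulli w) … ≥ 0`, every `n ≤ 5`, every `w`, pairwise distinct terminals).  PROOF: the `e3Terms` of the rows pass
prim-cert-2's three-copy checker `checkC` at the standard tuple of `K₃, K₄, K₅` resp. `K₄, K₅` (`native_decide`: all `4^m` tensor-Bernstein fibre sums `≥ 0`, i.e. the rows are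
Richards-comb positive there — `T_inc` on `K₅`: 824 965 zero / 223 611 positive fibres; `K4M_inc`: 520 784 / 527 792; two independent exact C implementations agree,
run/shared/lean/prim/prim-l12/prim-bnk-1/), then transport along vertex relabellings (`tRowHolds`/`fourRowHolds` bookkeeping of the companion files is re-proved here for the
new term lists).  Nothing is claimed beyond five vertices.
-/

namespace Summit.CriticalPhenomena.PercolationContinuityZ3.Theorems.SahiIncRows

open Finset MeasureTheory OneCutCert CovTransferCert E3GroupSepCert
open scoped BigOperators
open Literature.Probability.Percolation Literature.Probability.LatticeModels

variable {n : ℕ}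

/-! ## The increasing events -/

/-- `{u ↔ v} ∪ {x ↔ z}`. [this work] -/
def pUU (u v x z : Fin n) : CRel n → Bool := fun r => r u v || r x z

/-- The event of `pUU`. [this work] -/
theorem connEvent_pUU (u v x z : Fin n) : connEvent (pUU u v x z) = openConn u v ∪ openConn x z := by
  ext ω; simp [connEvent, pUU]

/-- `T_inc` terms at the triple `(a,b,c)`: `E₃(U_a,U_b,U_c)`. [this work] -/
def tIncTerms (t : Tri n) : List (CTerm n) :=
  e3Terms (pUU t.1 t.2.1 t.1 t.2.2) (pUU t.1 t.2.1 t.2.1 t.2.2) (pUU t.1 t.2.2 t.2.1 t.2.2)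

/-- `K4M_inc` terms at the quadruple `(a,b,c,d)`: `E₃(U₁,U₂,U₃)`. [this work] -/
def k4mTerms (x : Quad n) : List (CTerm n) :=
  e3Terms (pUU x.1 x.2.1 x.2.2.1 x.2.2.2) (pUU x.1 x.2.2.1 x.2.1 x.2.2.2) (pUU x.1 x.2.2.2 x.2.1 x.2.2.1)

/-! ## Transport -/

/-- `T_inc` terms under relabelling. [this work] -/
theorem tIncTerms_relP (τ : Fin n ≃ Fin n) (t : Tri n) :
    ((tIncTerms t).map fun z => (z.1, relP τ z.2.1, relP τ z.2.2.1, relP τ z.2.2.2)) = tIncTerms (trimap τ t) := by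
  obtain ⟨a, b, c⟩ := t
  rfl

/-- `K4M_inc` terms under relabelling. [this work] -/
theorem k4mTerms_relP (τ : Fin n ≃ Fin n) (x : Quad n) :
    ((k4mTerms x).map fun z => (z.1, relP τ z.2.1, relP τ z.2.2.1, relP τ z.2.2.2)) = k4mTerms (quadmap τ x) := by
  obtain ⟨a, b, c, d⟩ := x
  rfl

/-- Transport of `T_inc` along a relabelling. [this work] -/
theorem tInc_relabel (σ : Fin n ≃ Fin n) (w : Sym2 (Fin n) → unitInterval) (t : Tri n) (h : 0 ≤ cval w (tIncTerms t)) :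
    0 ≤ cval (relabelW σ w) (tIncTerms (trimap σ t)) := by
  rw [cval_map_relP, tIncTerms_relP, trimap_symm_trimap]
  exact h

/-- Transport of `T_inc` valid at all weights. [this work] -/
theorem tInc_forall_relabel (σ : Fin n ≃ Fin n) {t : Tri n} (h : ∀ w : Sym2 (Fin n) → unitInterval, 0 ≤ cval w (tIncTerms t))
    (w : Sym2 (Fin n) → unitInterval) : 0 ≤ cval w (tIncTerms (trimap σ t)) := by
  have hw : relabelW σ (fun e => w (sym2Equiv σ e)) = w := by
    funext e
    unfold relabelW
    simp only [Equiv.apply_symm_apply]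
  rw [← hw]
  exact tInc_relabel σ _ t (h _)

/-- Transport of `K4M_inc` along a relabelling. [this work] -/
theorem k4m_relabel (σ : Fin n ≃ Fin n) (w : Sym2 (Fin n) → unitInterval) (x : Quad n) (h : 0 ≤ cval w (k4mTerms x)) :
    0 ≤ cval (relabelW σ w) (k4mTerms (quadmap σ x)) := by
  rw [cval_map_relP, k4mTerms_relP, quadmap_symm_quadmap]
  exact h

/-- Transport of `K4M_inc` valid at all weights. [this work] -/
theorem k4m_forall_relabel (σ : Fin n ≃ Fin n) {x : Quad n} (h : ∀ w : Sym2 (Fin n) → unitInterval, 0 ≤ cval w (k4mTerms x))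
    (w : Sym2 (Fin n) → unitInterval) : 0 ≤ cval w (k4mTerms (quadmap σ x)) := by
  have hw : relabelW σ (fun e => w (sym2Equiv σ e)) = w := by
    funext e
    unfold relabelW
    simp only [Equiv.apply_symm_apply]
  rw [← hw]
  exact k4m_relabel σ _ x (h _)

/-! ## The evaluations -/

/-- `K₃`: `T_inc` passes the three-copy check (base `2^14`). [this work] -/
theorem checkTInc3 : checkC 3 14 (tIncTerms (tri₀ 3 le_rfl)) = true := by native_decide
/-- `K₄`: `T_inc` passes the three-copy check (base `2^23`). [this work] -/
theorem checkTInc4 : checkC 4 23 (tIncTerms (tri₀ 4 (by norm_num))) = true := by native_decide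
/-- `K₅`: `T_inc` passes the three-copy check (base `2^35`). [this work] -/
theorem checkTInc5 : checkC 5 35 (tIncTerms (tri₀ 5 (by norm_num))) = true := by native_decide
/-- `K₄`: `K4M_inc` passes the three-copy check (base `2^23`). [this work] -/
theorem checkK4M4 : checkC 4 23 (k4mTerms (quad₀ 4 le_rfl)) = true := by native_decide
/-- `K₅`: `K4M_inc` passes the three-copy check (base `2^35`). [this work] -/
theorem checkK4M5 : checkC 5 35 (k4mTerms (quad₀ 5 (by norm_num))) = true := by native_decide

/-- `T_inc` (term form) on every weighted graph with at most five vertices. [this work] -/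
theorem tInc_cval_le_five : ∀ n ≤ 5, ∀ (w : Sym2 (Fin n) → unitInterval) (a b c : Fin n), a ≠ b → a ≠ c → b ≠ c →
    0 ≤ cval w (tIncTerms (a, b, c)) := by
  intro n hn w a b c hab hac hbc
  interval_cases n
  · exact a.elim0
  · exact absurd (Subsingleton.elim a b) hab
  · have : c = a ∨ c = b := by omega
    rcases this with h | h
    · exact absurd h.symm hac
    · exact absurd h.symm hbc
  · obtain ⟨σ, hσ⟩ := cover_tri3 _ (mem_distinctTri hab hac hbc)
    rw [← hσ]
    exact tInc_forall_relabel σ (fun w' => checkC_sound 14 _ checkTInc3 w') w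
  · obtain ⟨σ, hσ⟩ := cover_tri4 _ (mem_distinctTri hab hac hbc)
    rw [← hσ]
    exact tInc_forall_relabel σ (fun w' => checkC_sound 23 _ checkTInc4 w') w
  · obtain ⟨σ, hσ⟩ := cover_tri5 _ (mem_distinctTri hab hac hbc)
    rw [← hσ]
    exact tInc_forall_relabel σ (fun w' => checkC_sound 35 _ checkTInc5 w') w

/-- `K4M_inc` (term form) on every weighted graph with at most five vertices. [this work] -/
theorem k4mInc_cval_le_five : ∀ n ≤ 5, ∀ (w : Sym2 (Fin n) → unitInterval) (a b c d : Fin n),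
    a ≠ b → a ≠ c → a ≠ d → b ≠ c → b ≠ d → c ≠ d → 0 ≤ cval w (k4mTerms (a, b, c, d)) := by
  intro n hn w a b c d hab hac had hbc hbd hcd
  interval_cases n
  · exact a.elim0
  · exact absurd (Subsingleton.elim a b) hab
  · have : c = a ∨ c = b := by omega
    rcases this with h | h
    · exact absurd h.symm hac
    · exact absurd h.symm hbc
  · have : d = a ∨ d = b ∨ d = c := by omega
    rcases this with h | h | h
    · exact absurd h.symm had
    · exact absurd h.symm hbd
    · exact absurd h.symm hcd
  · obtain ⟨σ, hσ⟩ := cover_quad4 _ (mem_distinctQuad hab hac had hbc hbd hcd)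
    rw [← hσ]
    exact k4m_forall_relabel σ (fun w' => checkC_sound 23 _ checkK4M4 w') w
  · obtain ⟨σ, hσ⟩ := cover_quad5 _ (mem_distinctQuad hab hac had hbc hbd hcd)
    rw [← hσ]
    exact k4m_forall_relabel σ (fun w' => checkC_sound 35 _ checkK4M5 w') w

/-! ## The theorems in `sahiE3` notation -/

/-- **`T_inc` on at most five vertices**: Sahi's `E₃ ≥ 0` for the increasing events `{a↔b} ∪ {a↔c}`, `{a↔b} ∪ {b↔c}`, `{a↔c} ∪ {b↔c}` of any three distinct
vertices of a weighted graph with `n ≤ 5` vertices (the increasing dual of 3PT-LB; prim-ineq-prove-2 MEMO-6). [this work] -/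
theorem tInc_le_five : ∀ n ≤ 5, ∀ (w : Sym2 (Fin n) → unitInterval) (a b c : Fin n), a ≠ b → a ≠ c → b ≠ c →
    0 ≤ sahiE3 (prodBernoulli w) (openConn a b ∪ openConn a c) (openConn a b ∪ openConn b c) (openConn a c ∪ openConn b c) := by
  intro n hn w a b c hab hac hbc
  have h := tInc_cval_le_five n hn w a b c hab hac hbc
  unfold cval tIncTerms e3Terms at h
  simp only [List.map_cons, List.map_nil, List.sum_cons, List.sum_nil, pr_pTrue] at h
  unfold pr at h
  simp only [connEvent_pAnd, connEvent_pUU] at h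
  rw [sahiE3_def]
  simp only [← Set.inter_assoc] at h ⊢
  push_cast at h
  linarith

/-- **`K4M_inc` on at most five vertices**: Sahi's `E₃ ≥ 0` for the increasing perfect-matching events `{a↔b} ∪ {c↔d}`, `{a↔c} ∪ {b↔d}`, `{a↔d} ∪ {b↔c}` of any four
distinct vertices of a weighted graph with `n ≤ 5` vertices. [this work] -/
theorem k4mInc_le_five : ∀ n ≤ 5, ∀ (w : Sym2 (Fin n) → unitInterval) (a b c d : Fin n), a ≠ b → a ≠ c → a ≠ d → b ≠ c → b ≠ d → c ≠ d →
    0 ≤ sahiE3 (prodBernoulli w) (openConn a b ∪ openConn c d) (openConn a c ∪ openConn b d) (openConn a d ∪ openConn b c) := by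
  intro n hn w a b c d hab hac had hbc hbd hcd
  have h := k4mInc_cval_le_five n hn w a b c d hab hac had hbc hbd hcd
  unfold cval k4mTerms e3Terms at h
  simp only [List.map_cons, List.map_nil, List.sum_cons, List.sum_nil, pr_pTrue] at h
  unfold pr at h
  simp only [connEvent_pAnd, connEvent_pUU] at h
  rw [sahiE3_def]
  simp only [← Set.inter_assoc] at h ⊢
  push_cast at h
  linarith

end Summit.CriticalPhenomena.PercolationContinuityZ3.Theorems.SahiIncRows
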